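import Summits.CriticalPhenomena.PercolationContinuityZ3.Theorems.PercNearOneGluingNoHeavyLowerTailAntitheticSeriesFar
import Summits.CriticalPhenomena.PercolationContinuityZ3.Theorems.PercNearOneGluingNoHeavyLowerTailAntitheticComparable
import Summits.CriticalPhenomena.PercolationContinuityZ3.Theorems.PercNearOneGluingNoHeavyLowerTailAntitheticSeriesLifts
import HarnessLib

/-!
# `NoHeavyLowerTail` (stmt-CriticalPhenomena-4575) — antithetic cluster pairs: **COMPARABLE GADGETS ARE TRANSPARENT FOR SERIES
# COMPOSITION** — ⊕-positivity AND the mixed sum (M) of `K₁ ∪_c K₂` from a COMPARABLE near factor `(K₁, s)` (e.g. a clique) and the DUAL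
# hypotheses of `(K₂, c)` alone (prim-hp-2 gen 65, HOME/MEMO-gen65.md §1)

Support file (`--supports stmt-CriticalPhenomena-4575`, hull-port prover `prim-hp-2`, gen 65).  No definitions, no named facts, no sorries;
standard axioms.  Setting of …AntitheticSeriesFar: `E₁ ∋ s` (near), `E₂` (far), disjoint, glued at `c`; `X₁, Y₁` clusters of `s` in `E₁`,
`A, B` clusters of `c` in `E₂`, composite clusters `X = X₁ ∪ {u | c ∈ X₁ ∧ u ∈ A}`, `Y = Y₁ ∪ {u | c ∈ Y₁ ∧ u ∈ B}`; 𝒮 = twisted-monotone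
super-odd test functions.  The near side is COMPARABLE (…AntitheticComparable): `X₁ T ⊆ Y₁ T` or `Y₁ T ⊆ X₁ T` in every colouring —
complete graphs, cliques with an arbitrarily attached source.

MECHANISM.  Split the near ⊕-event `{c ∈ X₁}` into NESTED contexts (`c ∉ Y₁`, hence `Y₁ ⊆ X₁`) and the complement-PAIRS
`{ω₁, ω₁ᶜ}` of contexts with `c ∈ X₁ ∩ Y₁`.  For a nested context the far functional `(A', B') ↦ K(X₁ ∪ [c]A', Y₁)` is again in 𝒮
(`Antithetic.Series.nested_lift_sum_nonneg`, …AntitheticSeriesLifts), so ANY far dual statement transfers termwise.  For a pair with `X₁ ⊆ Y₁` the two lifted points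
`(X₁ ∪ A, Y₁ ∪ B) ≼ (Y₁ ∪ A, X₁ ∪ B)` form an increasing pair (Chebyshev) and the pair-summed functional is EXACTLY antipodal, hence in 𝒮
(`Antithetic.Series.pair_lift_sum_nonneg`).  Because `c ∈ Y₁` is CONSTANT on each part, the far event may depend on it: nested parts use a
far event `predR`, pairs a far event `predB` — this is what lets the MIXED sum through (`{Q ∉ Y} = ¬(c ∈ Y₁ ∧ Q ∈ B)`), which the box
versions (…SeriesFar/…SeriesNear) cannot do for `Q` on the far side.
* `Antithetic.Series.event_sum_nonneg_of_comparable` — GENERIC FORM: near comparable; far events `predR, predB` determined by `ω ∩ E₂`,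
  each 𝒮×𝒮-positive for `(A, B)`; then `Σ K₁K₂(X, Y) ≥ 0` over `{c ∈ X₁ ∧ (c ∈ Y₁ → predB) ∧ (c ∉ Y₁ → predR)}`.
* `Antithetic.Series.oplus_nonneg_of_comparable` — ⊕: `(E₁, s)` comparable, `(E₂, c, P)` ⊕-positive (dually) ⇒ `(E₁ ∪ E₂, s, P)` ⊕-positive.
* `Antithetic.Series.mixed_nonneg_of_comparable` — (M): `(E₁, s)` comparable, `(E₂, c, P)` ⊕-positive and (M) at `(P, Q)` (dually, `Q` on
  the far side) ⇒ (M) at `(P, Q)` for `E₁ ∪ E₂` from `s`.  With the DUAL HANDLE THEOREM (…AntitheticHandleDual): prefixing a clique block at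
  the source costs nothing — `K_m ∪_c K + handle(P, Q)` holds whenever `K + handle(P, Q)` is obtained from (⊕) + (M) of `(K, c)`.
[cite: VandenbergHaggstromKahn2005, §1 p. 6 ("Harris' inequality"), §1 p. 3 (open cluster `C_s`)]
-/

noncomputable section

namespace Summit.CriticalPhenomena.PercolationContinuityZ3.Theorems

open Literature.Probability.Percolation
open scoped Classical

namespace Antithetic

namespace Series

variable {V : Type*} [Fintype V] {E₁ E₂ : Set (Sym2 V)} {s c : V}
  (hsep : ∀ e₁ ∈ E₁, ∀ e₂ ∈ E₂, ∀ v : V, v ∈ e₁ → v ∈ e₂ → v = c) (hs : ∀ e ∈ E₂, s ∈ e → s = c)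
include hsep hs

/-- **Series composition with a COMPARABLE near factor (generic event form).**  `E₁, E₂` disjoint, glued at `c`, `s` on the near side,
`(E₁, s)` comparable in every colouring.  FAR: two events `predR`, `predB` determined by `ω ∩ E₂`, each 𝒮×𝒮-positive for the clusters
`(A, B)` of `c` in `E₂`.  Then `Σ K₁K₂(X, Y) ≥ 0` over the colourings with `c ∈ X₁`, `predB` if `c ∈ Y₁` and `predR` if `c ∉ Y₁`, for all
`K₁, K₂ ∈ 𝒮` (clusters of `E₁ ∪ E₂` from `s`). [this work] -/
theorem event_sum_nonneg_of_comparable (hdis : Disjoint E₁ E₂)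
    (hcomp : ∀ T : Set (Sym2 V),
      openCluster (T ∩ E₁) s ⊆ openCluster (Tᶜ ∩ E₁) s ∨ openCluster (Tᶜ ∩ E₁) s ⊆ openCluster (T ∩ E₁) s)
    (predR predB : Set (Sym2 V) → Prop) [DecidablePred predR] [DecidablePred predB]
    (hpredR : ∀ ω ω' : Set (Sym2 V), ω ∩ E₂ = ω' ∩ E₂ → (predR ω ↔ predR ω'))
    (hpredB : ∀ ω ω' : Set (Sym2 V), ω ∩ E₂ = ω' ∩ E₂ → (predB ω ↔ predB ω'))
    (hplusR : ∀ K₁ K₂ : Set V → Set V → ℝ,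
      (∀ ⦃P P' Q Q' : Set V⦄, P ⊆ P' → Q' ⊆ Q → K₁ P Q ≤ K₁ P' Q') → (∀ P Q, 0 ≤ K₁ P Q + K₁ Q P) →
      (∀ ⦃P P' Q Q' : Set V⦄, P ⊆ P' → Q' ⊆ Q → K₂ P Q ≤ K₂ P' Q') → (∀ P Q, 0 ≤ K₂ P Q + K₂ Q P) →
      0 ≤ ∑ ω ∈ Finset.univ.filter (fun ω : Set (Sym2 V) => predR ω),
        K₁ (openCluster (ω ∩ E₂) c) (openCluster (ωᶜ ∩ E₂) c) * K₂ (openCluster (ω ∩ E₂) c) (openCluster (ωᶜ ∩ E₂) c))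
    (hplusB : ∀ K₁ K₂ : Set V → Set V → ℝ,
      (∀ ⦃P P' Q Q' : Set V⦄, P ⊆ P' → Q' ⊆ Q → K₁ P Q ≤ K₁ P' Q') → (∀ P Q, 0 ≤ K₁ P Q + K₁ Q P) →
      (∀ ⦃P P' Q Q' : Set V⦄, P ⊆ P' → Q' ⊆ Q → K₂ P Q ≤ K₂ P' Q') → (∀ P Q, 0 ≤ K₂ P Q + K₂ Q P) →
      0 ≤ ∑ ω ∈ Finset.univ.filter (fun ω : Set (Sym2 V) => predB ω),
        K₁ (openCluster (ω ∩ E₂) c) (openCluster (ωᶜ ∩ E₂) c) * K₂ (openCluster (ω ∩ E₂) c) (openCluster (ωᶜ ∩ E₂) c))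
    (K₁ K₂ : Set V → Set V → ℝ)
    (hK₁ : ∀ ⦃P P' Q Q' : Set V⦄, P ⊆ P' → Q' ⊆ Q → K₁ P Q ≤ K₁ P' Q') (hso₁ : ∀ P Q, 0 ≤ K₁ P Q + K₁ Q P)
    (hK₂ : ∀ ⦃P P' Q Q' : Set V⦄, P ⊆ P' → Q' ⊆ Q → K₂ P Q ≤ K₂ P' Q') (hso₂ : ∀ P Q, 0 ≤ K₂ P Q + K₂ Q P) :
    0 ≤ ∑ ω ∈ Finset.univ.filter (fun ω : Set (Sym2 V) =>
        c ∈ openCluster (ω ∩ E₁) s ∧ (c ∈ openCluster (ωᶜ ∩ E₁) s → predB ω) ∧ (c ∉ openCluster (ωᶜ ∩ E₁) s → predR ω)),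
      K₁ (openCluster (ω ∩ (E₁ ∪ E₂)) s) (openCluster (ωᶜ ∩ (E₁ ∪ E₂)) s) *
        K₂ (openCluster (ω ∩ (E₁ ∪ E₂)) s) (openCluster (ωᶜ ∩ (E₁ ∪ E₂)) s) := by
  -- notation
  let X₁ : Set (Sym2 V) → Set V := fun ω => openCluster (ω ∩ E₁) s
  let Y₁ : Set (Sym2 V) → Set V := fun ω => openCluster (ωᶜ ∩ E₁) s
  let A : Set (Sym2 V) → Set V := fun ω => openCluster (ω ∩ E₂) c
  let B : Set (Sym2 V) → Set V := fun ω => openCluster (ωᶜ ∩ E₂) c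
  let L : Set V → Set V → Set V := fun P S => P ∪ {u | c ∈ P ∧ u ∈ S}
  let KK : Set V → Set V → ℝ := fun P Q => K₁ P Q * K₂ P Q
  let ev : Set (Sym2 V) → Set (Sym2 V) → Prop := fun ω₁ ω₂ =>
    c ∈ X₁ ω₁ ∧ (c ∈ Y₁ ω₁ → predB ω₂) ∧ (c ∉ Y₁ ω₁ → predR ω₂)
  let Ψ₂ : Set (Sym2 V) → Set (Sym2 V) → ℝ := fun ω₁ ω₂ =>
    if ev ω₁ ω₂ then KK (L (X₁ ω₁) (A ω₂)) (L (Y₁ ω₁) (B ω₂)) else 0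
  have hdis' : ∀ e, e ∈ E₁ → e ∉ E₂ := fun e h1 h2 => Set.disjoint_left.1 hdis h1 h2
  have hXc : ∀ T : Set (Sym2 V), X₁ Tᶜ = Y₁ T := fun T => rfl
  have hYc : ∀ T : Set (Sym2 V), Y₁ Tᶜ = X₁ T := fun T => by show openCluster (Tᶜᶜ ∩ E₁) s = _; rw [compl_compl]
  -- (1) the target is the diagonal of `Ψ₂`
  have hdiag : ∑ ω ∈ Finset.univ.filter (fun ω : Set (Sym2 V) =>
        c ∈ openCluster (ω ∩ E₁) s ∧ (c ∈ openCluster (ωᶜ ∩ E₁) s → predB ω) ∧ (c ∉ openCluster (ωᶜ ∩ E₁) s → predR ω)),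
      K₁ (openCluster (ω ∩ (E₁ ∪ E₂)) s) (openCluster (ωᶜ ∩ (E₁ ∪ E₂)) s) *
        K₂ (openCluster (ω ∩ (E₁ ∪ E₂)) s) (openCluster (ωᶜ ∩ (E₁ ∪ E₂)) s) = ∑ ω, Ψ₂ ω ω := by
    rw [Finset.sum_filter]
    refine Finset.sum_congr rfl fun ω _ => ?_
    have e1 : openCluster (ω ∩ (E₁ ∪ E₂)) s = L (X₁ ω) (A ω) := OneSum.cluster_eq hsep hs ω
    have e2 : openCluster (ωᶜ ∩ (E₁ ∪ E₂)) s = L (Y₁ ω) (B ω) := OneSum.cluster_eq hsep hs ωᶜ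
    rw [e1, e2]
  -- (2) grafting: the double sum is `|Set (Sym2 V)|` times the diagonal
  let θ : Set (Sym2 V) × Set (Sym2 V) → Set (Sym2 V) × Set (Sym2 V) :=
    fun p => ((p.1 \ E₂) ∪ (p.2 ∩ E₂), (p.2 \ E₂) ∪ (p.1 ∩ E₂))
  have hθ : Function.Involutive θ := fun p => Cut.graft_graft E₂ p
  have g1 : ∀ a b : Set (Sym2 V), ((a \ E₂) ∪ (b ∩ E₂)) ∩ E₁ = a ∩ E₁ := by
    intro a b; ext e
    simp only [Set.mem_inter_iff, Set.mem_union, Set.mem_sdiff]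
    constructor
    · rintro ⟨h | h, he⟩
      · exact ⟨h.1, he⟩
      · exact absurd h.2 (hdis' e he)
    · rintro ⟨hc, he⟩; exact ⟨Or.inl ⟨hc, hdis' e he⟩, he⟩
  have g2 : ∀ a b : Set (Sym2 V), ((a \ E₂) ∪ (b ∩ E₂))ᶜ ∩ E₁ = aᶜ ∩ E₁ := by
    intro a b; ext e
    simp only [Set.mem_inter_iff, Set.mem_compl_iff, Set.mem_union, Set.mem_sdiff, not_or, not_and, not_not]
    constructor
    · rintro ⟨⟨h1, _⟩, he⟩; exact ⟨fun hc => hdis' e he (h1 hc), he⟩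
    · rintro ⟨hc, he⟩; exact ⟨⟨fun hc' => absurd hc' hc, fun _ he2 => absurd he2 (hdis' e he)⟩, he⟩
  have hΨθ : ∀ p : Set (Sym2 V) × Set (Sym2 V), Ψ₂ p.1 p.2 = Ψ₂ (θ p).1 (θ p).1 := by
    intro p
    have aR : predR (θ p).1 ↔ predR p.2 := hpredR _ _ (Cut.graft_inter_right p.1 p.2).1
    have aB : predB (θ p).1 ↔ predB p.2 := hpredB _ _ (Cut.graft_inter_right p.1 p.2).1
    have a1 : X₁ (θ p).1 = X₁ p.1 := by show openCluster (((p.1 \ E₂) ∪ (p.2 ∩ E₂)) ∩ E₁) s = _; rw [g1]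
    have a2 : Y₁ (θ p).1 = Y₁ p.1 := by show openCluster (((p.1 \ E₂) ∪ (p.2 ∩ E₂))ᶜ ∩ E₁) s = _; rw [g2]
    have a3 : A (θ p).1 = A p.2 := by
      show openCluster (((p.1 \ E₂) ∪ (p.2 ∩ E₂)) ∩ E₂) c = _; rw [(Cut.graft_inter_right p.1 p.2).1]
    have a4 : B (θ p).1 = B p.2 := by
      show openCluster (((p.1 \ E₂) ∪ (p.2 ∩ E₂))ᶜ ∩ E₂) c = _; rw [(Cut.graft_inter_right p.1 p.2).2]
    simp only [Ψ₂, ev, aR, aB, a1, a2, a3, a4]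
  have hrel : ∑ ω₁, ∑ ω₂, Ψ₂ ω₁ ω₂ = (Fintype.card (Set (Sym2 V)) : ℝ) * ∑ ω, Ψ₂ ω ω := by
    rw [← Fintype.sum_prod_type']
    rw [show ∑ p : Set (Sym2 V) × Set (Sym2 V), Ψ₂ p.1 p.2 = ∑ p : Set (Sym2 V) × Set (Sym2 V), Ψ₂ (θ p).1 (θ p).1 from
      Fintype.sum_congr _ _ hΨθ]
    rw [Fintype.sum_bijective θ hθ.bijective (fun p => Ψ₂ (θ p).1 (θ p).1) (fun q => Ψ₂ q.1 q.1) (fun p => rfl)]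
    rw [Fintype.sum_prod_type, Finset.mul_sum]
    refine Finset.sum_congr rfl fun a _ => ?_
    show ∑ _d : Set (Sym2 V), Ψ₂ a a = _
    rw [Finset.sum_const, Finset.card_univ, nsmul_eq_mul]
  -- (3) the inner far sums, by near context
  let ΦB : Set (Sym2 V) → ℝ := fun ω₁ =>
    ∑ ω₂ ∈ Finset.univ.filter (fun ω : Set (Sym2 V) => predB ω), KK (L (X₁ ω₁) (A ω₂)) (L (Y₁ ω₁) (B ω₂))
  let ΦR : Set (Sym2 V) → ℝ := fun ω₁ =>
    ∑ ω₂ ∈ Finset.univ.filter (fun ω : Set (Sym2 V) => predR ω), KK (L (X₁ ω₁) (A ω₂)) (L (Y₁ ω₁) (B ω₂))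
  let Φ : Set (Sym2 V) → ℝ := fun ω₁ => if c ∈ Y₁ ω₁ then ΦB ω₁ else ΦR ω₁
  have hΦ : ∀ ω₁, ∑ ω₂, Ψ₂ ω₁ ω₂ = if c ∈ X₁ ω₁ then Φ ω₁ else 0 := by
    intro ω₁
    by_cases hX : c ∈ X₁ ω₁
    · rw [if_pos hX]
      by_cases hY : c ∈ Y₁ ω₁
      · have : ∀ ω₂, Ψ₂ ω₁ ω₂ = if predB ω₂ then KK (L (X₁ ω₁) (A ω₂)) (L (Y₁ ω₁) (B ω₂)) else 0 := by
          intro ω₂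
          have hev : ev ω₁ ω₂ ↔ predB ω₂ :=
            ⟨fun h => h.2.1 hY, fun h => ⟨hX, fun _ => h, fun h' => absurd hY h'⟩⟩
          simp only [Ψ₂, hev]
        have hΦ' : Φ ω₁ = ΦB ω₁ := by simp only [Φ, hY, if_true]
        rw [hΦ']
        show _ = ∑ ω₂ ∈ Finset.univ.filter (fun ω : Set (Sym2 V) => predB ω), KK (L (X₁ ω₁) (A ω₂)) (L (Y₁ ω₁) (B ω₂))
        simp_rw [this]
        rw [← Finset.sum_filter]
      · have : ∀ ω₂, Ψ₂ ω₁ ω₂ = if predR ω₂ then KK (L (X₁ ω₁) (A ω₂)) (L (Y₁ ω₁) (B ω₂)) else 0 := by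
          intro ω₂
          have hev : ev ω₁ ω₂ ↔ predR ω₂ :=
            ⟨fun h => h.2.2 hY, fun h => ⟨hX, fun h' => absurd h' hY, fun _ => h⟩⟩
          simp only [Ψ₂, hev]
        have hΦ' : Φ ω₁ = ΦR ω₁ := by simp only [Φ, hY, if_false]
        rw [hΦ']
        show _ = ∑ ω₂ ∈ Finset.univ.filter (fun ω : Set (Sym2 V) => predR ω), KK (L (X₁ ω₁) (A ω₂)) (L (Y₁ ω₁) (B ω₂))
        simp_rw [this]
        rw [← Finset.sum_filter]
    · rw [if_neg hX]
      refine Finset.sum_eq_zero fun ω₂ _ => ?_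
      have hev : ¬ ev ω₁ ω₂ := fun h => hX h.1
      simp only [Ψ₂, hev, if_false]
  -- (4) the double sum is nonnegative: parts `{ω₁, ω₁ᶜ} ∩ {c ∈ X₁}`
  have hdbl : 0 ≤ ∑ ω₁, ∑ ω₂, Ψ₂ ω₁ ω₂ := by
    simp_rw [hΦ]
    rw [← Finset.sum_filter]
    let D : Finset (Set (Sym2 V)) := Finset.univ.filter fun ω : Set (Sym2 V) => c ∈ X₁ ω
    have hmemD : ∀ T : Set (Sym2 V), T ∈ D ↔ c ∈ X₁ T := fun T => by
      simp only [D, Finset.mem_filter, Finset.mem_univ, true_and]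
    let Pt : Set (Sym2 V) → Finset (Set (Sym2 V)) := fun T => ({T, Tᶜ} : Finset (Set (Sym2 V))).filter fun M => M ∈ D
    show 0 ≤ ∑ T ∈ D, Φ T
    refine sum_nonneg_of_parts D Φ Pt ?_ ?_ ?_ ?_
    · intro T hT
      exact Finset.mem_filter.2 ⟨Finset.mem_insert_self _ _, hT⟩
    · intro T _ M hM
      exact (Finset.mem_filter.1 hM).2
    · intro T _ M hM
      have hM' := (Finset.mem_filter.1 hM).1
      rw [Finset.mem_insert, Finset.mem_singleton] at hM'
      rcases hM' with rfl | rfl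
      · rfl
      · show ({Tᶜ, Tᶜᶜ} : Finset (Set (Sym2 V))).filter (fun M => M ∈ D) =
          ({T, Tᶜ} : Finset (Set (Sym2 V))).filter fun M => M ∈ D
        rw [compl_compl, Finset.pair_comm]
    · intro T hT
      have hcX : c ∈ X₁ T := (hmemD T).1 hT
      by_cases hc : Tᶜ ∈ D
      · -- both contexts: `c ∈ X₁ ∩ Y₁`, far event `predB` for both, a complement pair
        have hcY : c ∈ Y₁ T := by rw [← hXc]; exact (hmemD Tᶜ).1 hc
        have hne : T ≠ Tᶜ := by
          intro h
          have h1 : s(s, s) ∈ T ↔ s(s, s) ∈ Tᶜ := by rw [← h]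
          rw [Set.mem_compl_iff] at h1
          exact iff_not_self h1
        have hPt : Pt T = {T, Tᶜ} := by
          ext M
          simp only [Pt, Finset.mem_filter, Finset.mem_insert, Finset.mem_singleton]
          constructor
          · exact fun h => h.1
          · rintro (rfl | rfl)
            · exact ⟨Or.inl rfl, hT⟩
            · exact ⟨Or.inr rfl, hc⟩
        rw [hPt, Finset.sum_pair hne]
        have hcY' : c ∈ Y₁ Tᶜ := by rw [hYc]; exact hcX
        show 0 ≤ (if c ∈ Y₁ T then ΦB T else ΦR T) + (if c ∈ Y₁ Tᶜ then ΦB Tᶜ else ΦR Tᶜ)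
        rw [if_pos hcY, if_pos hcY']
        show 0 ≤ (∑ ω₂ ∈ Finset.univ.filter (fun ω : Set (Sym2 V) => predB ω), KK (L (X₁ T) (A ω₂)) (L (Y₁ T) (B ω₂))) +
          ∑ ω₂ ∈ Finset.univ.filter (fun ω : Set (Sym2 V) => predB ω), KK (L (X₁ Tᶜ) (A ω₂)) (L (Y₁ Tᶜ) (B ω₂))
        rw [hXc, hYc, ← Finset.sum_add_distrib]
        rcases hcomp T with h | h
        · exact pair_lift_sum_nonneg _ A B c hplusB hK₁ hso₁ hK₂ hso₂ (X₁ T) (Y₁ T) h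
        · have := pair_lift_sum_nonneg _ A B c hplusB hK₁ hso₁ hK₂ hso₂ (Y₁ T) (X₁ T) h
          refine le_of_le_of_eq this (Finset.sum_congr rfl fun ω₂ _ => ?_)
          exact add_comm _ _
      · -- only `T`: `c ∉ Y₁ T`, hence nested (`Y₁ ⊆ X₁`), far event `predR`
        have hcY : c ∉ Y₁ T := fun h => hc ((hmemD Tᶜ).2 (by rw [hXc]; exact h))
        have hPt : Pt T = {T} := by
          ext M
          simp only [Pt, Finset.mem_filter, Finset.mem_insert, Finset.mem_singleton]
          constructor
          · rintro ⟨rfl | rfl, hM⟩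
            · rfl
            · exact absurd hM hc
          · rintro rfl; exact ⟨Or.inl rfl, hT⟩
        rw [hPt, Finset.sum_singleton]
        have hYX : Y₁ T ⊆ X₁ T := by
          rcases hcomp T with h | h
          · exact absurd (h hcX) hcY
          · exact h
        show 0 ≤ if c ∈ Y₁ T then ΦB T else ΦR T
        rw [if_neg hcY]
        exact nested_lift_sum_nonneg _ A B c hplusR hK₁ hso₁ hK₂ hso₂ (X₁ T) (Y₁ T) hYX
  -- (5) conclude
  rw [hdiag]
  have hN : (0 : ℝ) < (Fintype.card (Set (Sym2 V)) : ℝ) := by exact_mod_cast Fintype.card_pos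
  rw [hrel] at hdbl
  exact (mul_nonneg_iff_of_pos_left hN).1 hdbl

/-- **⊕ across a comparable near factor.**  `(E₁, s)` comparable in every colouring, `P ≠ s` on the far side, `(E₂, c, P)` ⊕-positive
(dually) ⇒ `(E₁ ∪ E₂, s, P)` ⊕-positive. [this work] -/
theorem oplus_nonneg_of_comparable (hdis : Disjoint E₁ E₂)
    (hcomp : ∀ T : Set (Sym2 V),
      openCluster (T ∩ E₁) s ⊆ openCluster (Tᶜ ∩ E₁) s ∨ openCluster (Tᶜ ∩ E₁) s ⊆ openCluster (T ∩ E₁) s)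
    {P : V} (hPs : P ≠ s) (hPE : ∀ e ∈ E₁, P ∈ e → P = c)
    (hplus : ∀ K₁ K₂ : Set V → Set V → ℝ,
      (∀ ⦃A A' B B' : Set V⦄, A ⊆ A' → B' ⊆ B → K₁ A B ≤ K₁ A' B') → (∀ A B, 0 ≤ K₁ A B + K₁ B A) →
      (∀ ⦃A A' B B' : Set V⦄, A ⊆ A' → B' ⊆ B → K₂ A B ≤ K₂ A' B') → (∀ A B, 0 ≤ K₂ A B + K₂ B A) →
      0 ≤ ∑ ω ∈ Finset.univ.filter (fun ω : Set (Sym2 V) => P ∈ openCluster (ω ∩ E₂) c),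
        K₁ (openCluster (ω ∩ E₂) c) (openCluster (ωᶜ ∩ E₂) c) * K₂ (openCluster (ω ∩ E₂) c) (openCluster (ωᶜ ∩ E₂) c))
    (K₁ K₂ : Set V → Set V → ℝ)
    (hK₁ : ∀ ⦃A A' B B' : Set V⦄, A ⊆ A' → B' ⊆ B → K₁ A B ≤ K₁ A' B') (hso₁ : ∀ A B, 0 ≤ K₁ A B + K₁ B A)
    (hK₂ : ∀ ⦃A A' B B' : Set V⦄, A ⊆ A' → B' ⊆ B → K₂ A B ≤ K₂ A' B') (hso₂ : ∀ A B, 0 ≤ K₂ A B + K₂ B A) :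
    0 ≤ ∑ ω ∈ Finset.univ.filter (fun ω : Set (Sym2 V) => P ∈ openCluster (ω ∩ (E₁ ∪ E₂)) s),
      K₁ (openCluster (ω ∩ (E₁ ∪ E₂)) s) (openCluster (ωᶜ ∩ (E₁ ∪ E₂)) s) *
        K₂ (openCluster (ω ∩ (E₁ ∪ E₂)) s) (openCluster (ωᶜ ∩ (E₁ ∪ E₂)) s) := by
  have hfilter : Finset.univ.filter (fun ω : Set (Sym2 V) => P ∈ openCluster (ω ∩ (E₁ ∪ E₂)) s) =
      Finset.univ.filter (fun ω : Set (Sym2 V) => c ∈ openCluster (ω ∩ E₁) s ∧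
        (c ∈ openCluster (ωᶜ ∩ E₁) s → P ∈ openCluster (ω ∩ E₂) c) ∧
        (c ∉ openCluster (ωᶜ ∩ E₁) s → P ∈ openCluster (ω ∩ E₂) c)) :=
    Finset.filter_congr fun ω _ => by
      rw [far_event_iff hsep hs hPs hPE ω]
      constructor
      · rintro ⟨hc, hP⟩; exact ⟨hc, fun _ => hP, fun _ => hP⟩
      · rintro ⟨hc, h1, h2⟩
        exact ⟨hc, (em (c ∈ openCluster (ωᶜ ∩ E₁) s)).elim h1 h2⟩
  rw [hfilter]
  refine event_sum_nonneg_of_comparable hsep hs hdis hcomp (fun ω => P ∈ openCluster (ω ∩ E₂) c)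
    (fun ω => P ∈ openCluster (ω ∩ E₂) c) ?_ ?_ hplus hplus K₁ K₂ hK₁ hso₁ hK₂ hso₂
  · intro ω ω' h
    show P ∈ openCluster (ω ∩ E₂) c ↔ P ∈ openCluster (ω' ∩ E₂) c
    rw [h]
  · intro ω ω' h
    show P ∈ openCluster (ω ∩ E₂) c ↔ P ∈ openCluster (ω' ∩ E₂) c
    rw [h]

/-- **The mixed sum (M) across a comparable near factor, `Q` on the FAR side.**  `(E₁, s)` comparable in every colouring; `P, Q ≠ s` on the
far side; `(E₂, c, P)` ⊕-positive and with (M) at `(P, Q)` (both dually).  Then `Σ_{P ∈ X, Q ∉ Y} K₁K₂(X, Y) ≥ 0` for `E₁ ∪ E₂` from `s`,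
all `K₁, K₂ ∈ 𝒮`. [this work] -/
theorem mixed_nonneg_of_comparable (hdis : Disjoint E₁ E₂)
    (hcomp : ∀ T : Set (Sym2 V),
      openCluster (T ∩ E₁) s ⊆ openCluster (Tᶜ ∩ E₁) s ∨ openCluster (Tᶜ ∩ E₁) s ⊆ openCluster (T ∩ E₁) s)
    {P Q : V} (hPs : P ≠ s) (hPE : ∀ e ∈ E₁, P ∈ e → P = c) (hQs : Q ≠ s) (hQE : ∀ e ∈ E₁, Q ∈ e → Q = c)
    (hplus : ∀ K₁ K₂ : Set V → Set V → ℝ,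
      (∀ ⦃A A' B B' : Set V⦄, A ⊆ A' → B' ⊆ B → K₁ A B ≤ K₁ A' B') → (∀ A B, 0 ≤ K₁ A B + K₁ B A) →
      (∀ ⦃A A' B B' : Set V⦄, A ⊆ A' → B' ⊆ B → K₂ A B ≤ K₂ A' B') → (∀ A B, 0 ≤ K₂ A B + K₂ B A) →
      0 ≤ ∑ ω ∈ Finset.univ.filter (fun ω : Set (Sym2 V) => P ∈ openCluster (ω ∩ E₂) c),
        K₁ (openCluster (ω ∩ E₂) c) (openCluster (ωᶜ ∩ E₂) c) * K₂ (openCluster (ω ∩ E₂) c) (openCluster (ωᶜ ∩ E₂) c))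
    (hmixed : ∀ K₁ K₂ : Set V → Set V → ℝ,
      (∀ ⦃A A' B B' : Set V⦄, A ⊆ A' → B' ⊆ B → K₁ A B ≤ K₁ A' B') → (∀ A B, 0 ≤ K₁ A B + K₁ B A) →
      (∀ ⦃A A' B B' : Set V⦄, A ⊆ A' → B' ⊆ B → K₂ A B ≤ K₂ A' B') → (∀ A B, 0 ≤ K₂ A B + K₂ B A) →
      0 ≤ ∑ ω ∈ Finset.univ.filter (fun ω : Set (Sym2 V) =>
          P ∈ openCluster (ω ∩ E₂) c ∧ Q ∉ openCluster (ωᶜ ∩ E₂) c),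
        K₁ (openCluster (ω ∩ E₂) c) (openCluster (ωᶜ ∩ E₂) c) * K₂ (openCluster (ω ∩ E₂) c) (openCluster (ωᶜ ∩ E₂) c))
    (K₁ K₂ : Set V → Set V → ℝ)
    (hK₁ : ∀ ⦃A A' B B' : Set V⦄, A ⊆ A' → B' ⊆ B → K₁ A B ≤ K₁ A' B') (hso₁ : ∀ A B, 0 ≤ K₁ A B + K₁ B A)
    (hK₂ : ∀ ⦃A A' B B' : Set V⦄, A ⊆ A' → B' ⊆ B → K₂ A B ≤ K₂ A' B') (hso₂ : ∀ A B, 0 ≤ K₂ A B + K₂ B A) :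
    0 ≤ ∑ ω ∈ Finset.univ.filter (fun ω : Set (Sym2 V) =>
        P ∈ openCluster (ω ∩ (E₁ ∪ E₂)) s ∧ Q ∉ openCluster (ωᶜ ∩ (E₁ ∪ E₂)) s),
      K₁ (openCluster (ω ∩ (E₁ ∪ E₂)) s) (openCluster (ωᶜ ∩ (E₁ ∪ E₂)) s) *
        K₂ (openCluster (ω ∩ (E₁ ∪ E₂)) s) (openCluster (ωᶜ ∩ (E₁ ∪ E₂)) s) := by
  have hfilter : Finset.univ.filter (fun ω : Set (Sym2 V) =>
        P ∈ openCluster (ω ∩ (E₁ ∪ E₂)) s ∧ Q ∉ openCluster (ωᶜ ∩ (E₁ ∪ E₂)) s) =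
      Finset.univ.filter (fun ω : Set (Sym2 V) => c ∈ openCluster (ω ∩ E₁) s ∧
        (c ∈ openCluster (ωᶜ ∩ E₁) s → P ∈ openCluster (ω ∩ E₂) c ∧ Q ∉ openCluster (ωᶜ ∩ E₂) c) ∧
        (c ∉ openCluster (ωᶜ ∩ E₁) s → P ∈ openCluster (ω ∩ E₂) c)) :=
    Finset.filter_congr fun ω _ => by
      rw [far_event_iff hsep hs hPs hPE ω]
      have hQ : Q ∈ openCluster (ωᶜ ∩ (E₁ ∪ E₂)) s ↔
          c ∈ openCluster (ωᶜ ∩ E₁) s ∧ Q ∈ openCluster (ωᶜ ∩ E₂) c := far_event_iff hsep hs hQs hQE ωᶜ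
      rw [hQ]
      constructor
      · rintro ⟨⟨hc, hP⟩, hQ'⟩
        exact ⟨hc, fun hY => ⟨hP, fun hQB => hQ' ⟨hY, hQB⟩⟩, fun _ => hP⟩
      · rintro ⟨hc, h1, h2⟩
        by_cases hY : c ∈ openCluster (ωᶜ ∩ E₁) s
        · exact ⟨⟨hc, (h1 hY).1⟩, fun h => (h1 hY).2 h.2⟩
        · exact ⟨⟨hc, h2 hY⟩, fun h => hY h.1⟩
  rw [hfilter]
  refine event_sum_nonneg_of_comparable hsep hs hdis hcomp (fun ω => P ∈ openCluster (ω ∩ E₂) c)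
    (fun ω => P ∈ openCluster (ω ∩ E₂) c ∧ Q ∉ openCluster (ωᶜ ∩ E₂) c) ?_ ?_ hplus hmixed K₁ K₂ hK₁ hso₁ hK₂ hso₂
  · intro ω ω' h
    show P ∈ openCluster (ω ∩ E₂) c ↔ P ∈ openCluster (ω' ∩ E₂) c
    rw [h]
  · intro ω ω' h
    have h' : ωᶜ ∩ E₂ = ω'ᶜ ∩ E₂ := by
      ext e
      simp only [Set.mem_inter_iff, Set.mem_compl_iff]
      constructor
      · rintro ⟨h1, he⟩
        exact ⟨fun h2 => h1 (by have : e ∈ ω' ∩ E₂ := ⟨h2, he⟩; rw [← h] at this; exact this.1), he⟩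
      · rintro ⟨h1, he⟩
        exact ⟨fun h2 => h1 (by have : e ∈ ω ∩ E₂ := ⟨h2, he⟩; rw [h] at this; exact this.1), he⟩
    show P ∈ openCluster (ω ∩ E₂) c ∧ Q ∉ openCluster (ωᶜ ∩ E₂) c ↔
      P ∈ openCluster (ω' ∩ E₂) c ∧ Q ∉ openCluster (ω'ᶜ ∩ E₂) c
    rw [h, h']

end Series

end Antithetic

end Summit.CriticalPhenomena.PercolationContinuityZ3.Theorems
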